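import Literature.Probability.LatticeModels.MTP2FourFunctions
import Mathlib.MeasureTheory.Measure.Prod

/-!
# The diagonal lemma: an a.e.-PAIR lattice inequality on a chain holds a.e. on the diagonal

Support file of the Sahi cell (`prim-sahi`, typer seat, generation 19; `--supports stmt-CriticalPhenomena-4575`).
Theorems only (no definitions, no named facts, no sorries).  Part 1 of the almost-everywhere four functions
theorem (`SahiAEFourFunctions.lean`).

Karlin–Rinott's continuous four functions theorem ([KarlinRinott1980] Thm. 2.1; tree
`Literature.Probability.LatticeModels.lintegral_four_functions`) assumes `f₁(x) f₂(y) ≤ f₃(x ∨ y) f₄(x ∧ y)` for ALL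
pairs; Milgrom–Weber's Theorem 24 ([MilgromWeber1982], Appendix; tree `AffiliationDensity.lean`) is stated for
densities satisfying the lattice inequality for ALMOST EVERY PAIR, its printed 'if' half running an induction on the
dimension (conditioning on `Z₁ ∈ {z₁, z₁'}`) which "omit[s] the specification almost everywhere".  Neither induction
survives verbatim under the a.e.-pair hypothesis: both use the inequality on pairs of points SHARING one coordinate —
Karlin–Rinott in the one-dimensional comparison (the `2 × 2` step needs the two DIAGONAL pairs with equal heights),
Milgrom–Weber in "it can be routinely verified that [`f(z₁',·) + f(z₁,·)`] is affiliated" — and such pairs form a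
`ρ ⊗ ρ`-null set when `ρ` is diffuse.  This file supplies the missing step.

* `ae_le_of_ae_pair_le` — **THE DIAGONAL LEMMA** (elementary; no differentiation theory, no measurability, no
  topology): on a linearly ordered measurable space with an s-finite measure `ρ`, if
  `a(x) b(y) ≤ c(x ∨ y) d(x ∧ y)` for `ρ ⊗ ρ`-a.e. `(x, y)` (`a, b, c, d : X → [0,∞]` arbitrary), then
  `a(x) b(x) ≤ c(x) d(x)` for `ρ`-a.e. `x`.  Proof: the exceptional set is covered by countably many level sets
  `G = {a ≥ α} ∩ {b ≥ β} ∩ {c ≤ γ} ∩ {d ≤ δ}` with thresholds in a countable dense subset of `[0,∞]` (with `0, ∞` adjoined) and `γδ < αβ`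
  (`exists_thr_le_mul_gt`, `exists_thr_ge_mul_lt`); since `x ∨ y, x ∧ y ∈ {x, y}` on a chain, the hypothesis
  fails at EVERY point of `G × G`, so `ρ(G)² = (ρ ⊗ ρ)(G × G) = 0`.
* `add_le_add_of_pair_of_diag` — the `2 × 2` step of Thm. 2.1 from the four inequalities that are available
  almost everywhere (the pair, its swap, the two diagonal ones).
* `measurePreserving_shuffle` — `((y,z),(t,s)) ↦ ((t,y),(s,z))` preserves fourfold product measures (bookkeeping
  for transporting an a.e.-pair hypothesis through `ℝ^{n+1} ≃ ℝ × ℝⁿ`).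

ATTRIBUTION (doc-only v2, cell finding A33-1).  The STATEMENT of the diagonal lemma is in print: it is
[BattyBollmann1980] Prop. 2.1 ("any selectively paired measure space is diagonally settled": on a totally ordered
σ-finite measure space, `μ²`-a.e. compatibility `f₁(x) f₂(y) ≤ f₃(x ∨ y) f₄(x ∧ y)` implies diagonal
`μ`-a.e. compatibility `f₁(x) f₂(x) ≤ f₃(x) f₄(x)`), proved there by a two-sided approximation on the level sets
of `f₂/f₄` and `f₂/f₃`; the countable-threshold-box proof below is a different proof of the same statement.  Batty and
Bollmann then obtain the almost-everywhere four functions theorem on finite products of totally ordered measure spaces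
(their Prop. 3.4, Lemma 3.6, Thm. 3.7), which is what `SahiAEFourFunctions.lean` re-derives on `ℝ^ι`, and show by
Example 2.3 that it FAILS for infinite products (tree: `Literature/Probability/LatticeModels/FourFunctionsAEInfinite.lean`).

No sorries, no new axioms.
-/

noncomputable section

namespace Summit.CriticalPhenomena.PercolationContinuityZ3.Theorems.SahiAEFourFunctions

open MeasureTheory Set Filter
open Literature.Probability.LatticeModels
open scoped ENNReal NNReal

/-! ### Countable thresholds -/

/-- Lower thresholds: if `u < a b` then `u < α β` for some `α ≤ a`, `β ≤ b` taken from `{0, ∞} ∪ s`, `s` any dense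
set of `[0,∞]`. [folklore] -/
private theorem exists_thr_le_mul_gt {s : Set ℝ≥0∞} (hs : Dense s) {a b u : ℝ≥0∞} (h : u < a * b) :
    ∃ α ∈ insert 0 (insert ⊤ s), ∃ β ∈ insert 0 (insert ⊤ s), α ≤ a ∧ β ≤ b ∧ u < α * β := by
  have memS : ∀ {x}, x ∈ s → x ∈ insert 0 (insert ⊤ s) := fun hx => mem_insert_of_mem _ (mem_insert_of_mem _ hx)
  have topS : (⊤ : ℝ≥0∞) ∈ insert 0 (insert ⊤ s) := mem_insert_of_mem _ (mem_insert _ _)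
  -- the case `b ≠ 0, ∞` (for any `a`)
  have aux : ∀ {a b u : ℝ≥0∞}, b ≠ 0 → b ≠ ∞ → u < a * b →
      ∃ α ∈ insert 0 (insert ⊤ s), ∃ β ∈ insert 0 (insert ⊤ s), α ≤ a ∧ β ≤ b ∧ u < α * β := by
    intro a b u hb0 hbT h
    have h1 : u / b < a := (ENNReal.div_lt_iff (Or.inl hb0) (Or.inl hbT)).2 h
    obtain ⟨α, hαs, hα₁, hα₂⟩ := hs.exists_between h1
    have hα0 : α ≠ 0 := (lt_of_le_of_lt zero_le hα₁).ne'
    have hαT : α ≠ ∞ := hα₂.ne_top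
    have h2 : u < α * b := (ENNReal.div_lt_iff (Or.inl hb0) (Or.inl hbT)).1 hα₁
    have h3 : u / α < b := by
      refine (ENNReal.div_lt_iff (Or.inl hα0) (Or.inl hαT)).2 ?_
      rwa [mul_comm] at h2
    obtain ⟨β, hβs, hβ₁, hβ₂⟩ := hs.exists_between h3
    have h4 : u < β * α := (ENNReal.div_lt_iff (Or.inl hα0) (Or.inl hαT)).1 hβ₁
    exact ⟨α, memS hαs, β, memS hβs, hα₂.le, hβ₂.le, by rwa [mul_comm] at h4⟩
  by_cases hbT : b = ∞
  · by_cases haT : a = ∞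
    · refine ⟨⊤, topS, ⊤, topS, haT.ge, hbT.ge, ?_⟩
      rw [ENNReal.top_mul_top]; exact h.trans_le le_top
    · have ha0 : a ≠ 0 := by rintro rfl; simp at h
      obtain ⟨α, hα, β, hβ, hαa, hβb, hlt⟩ := aux ha0 haT (show u < b * a by rwa [mul_comm] at h)
      exact ⟨β, hβ, α, hα, hβb, hαa, by rwa [mul_comm] at hlt⟩
  · have hb0 : b ≠ 0 := by rintro rfl; simp at h
    exact aux hb0 hbT h

/-- Upper thresholds: if `c d < w` then `γ δ < w` for some `γ ≥ c`, `δ ≥ d` taken from `{0, ∞} ∪ s`, `s` any dense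
set of `[0,∞]`. [folklore] -/
private theorem exists_thr_ge_mul_lt {s : Set ℝ≥0∞} (hs : Dense s) {c d w : ℝ≥0∞} (h : c * d < w) :
    ∃ γ ∈ insert 0 (insert ⊤ s), ∃ δ ∈ insert 0 (insert ⊤ s), c ≤ γ ∧ d ≤ δ ∧ γ * δ < w := by
  have memS : ∀ {x}, x ∈ s → x ∈ insert 0 (insert ⊤ s) := fun hx => mem_insert_of_mem _ (mem_insert_of_mem _ hx)
  have topS : (⊤ : ℝ≥0∞) ∈ insert 0 (insert ⊤ s) := mem_insert_of_mem _ (mem_insert _ _)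
  have zeroS : (0 : ℝ≥0∞) ∈ insert 0 (insert ⊤ s) := mem_insert _ _
  have hw : 0 < w := lt_of_le_of_lt zero_le h
  by_cases hc : c = 0
  · refine ⟨0, zeroS, ⊤, topS, hc.le, le_top, ?_⟩
    rw [zero_mul]; exact hw
  by_cases hd : d = 0
  · refine ⟨⊤, topS, 0, zeroS, le_top, hd.le, ?_⟩
    rw [mul_zero]; exact hw
  have hcT : c ≠ ∞ := by
    rintro rfl; rw [ENNReal.top_mul hd] at h; exact (not_top_lt h).elim
  have hdT : d ≠ ∞ := by
    rintro rfl; rw [ENNReal.mul_top hc] at h; exact (not_top_lt h).elim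
  have h1 : c < w / d := (ENNReal.lt_div_iff_mul_lt (Or.inl hd) (Or.inl hdT)).2 h
  obtain ⟨γ, hγs, hγ₁, hγ₂⟩ := hs.exists_between h1
  have hγ0 : γ ≠ 0 := (lt_of_le_of_lt zero_le hγ₁).ne'
  have hγT : γ ≠ ∞ := hγ₂.ne_top
  have h2 : γ * d < w := (ENNReal.lt_div_iff_mul_lt (Or.inl hd) (Or.inl hdT)).1 hγ₂
  have h3 : d < w / γ := by
    refine (ENNReal.lt_div_iff_mul_lt (Or.inl hγ0) (Or.inl hγT)).2 ?_
    rwa [mul_comm] at h2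
  obtain ⟨δ, hδs, hδ₁, hδ₂⟩ := hs.exists_between h3
  have h4 : δ * γ < w := (ENNReal.lt_div_iff_mul_lt (Or.inl hγ0) (Or.inl hγT)).1 hδ₂
  exact ⟨γ, memS hγs, δ, memS hδs, hγ₁.le, hδ₁.le, by rwa [mul_comm] at h4⟩

/-! ### The diagonal lemma -/

/-- **The diagonal lemma.**  Let `X` be linearly ordered, `ρ` an s-finite measure on `X`, and
`a, b, c, d : X → [0,∞]` arbitrary functions with `a(x) b(y) ≤ c(x ∨ y) d(x ∧ y)` for `ρ ⊗ ρ`-almost every pair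
`(x, y)`.  Then `a(x) b(x) ≤ c(x) d(x)` for `ρ`-almost every `x` — although the diagonal is `ρ ⊗ ρ`-null for a
diffuse `ρ`.  (Level sets `G = {a ≥ α} ∩ {b ≥ β} ∩ {c ≤ γ} ∩ {d ≤ δ}`, `γδ < αβ`, thresholds in a countable dense
set with `0, ∞` adjoined: the hypothesis fails at every point of `G × G`, so `ρ(G)² = 0`; the exceptional set is
their countable union.)  The statement is Batty–Bollmann's "a selectively paired measure space is diagonally settled";
the proof here differs from the printed one. [cite: BattyBollmann1980, Prop. 2.1] -/
theorem ae_le_of_ae_pair_le {X : Type*} [LinearOrder X] [MeasurableSpace X] (ρ : Measure X) [SFinite ρ]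
    (a b c d : X → ℝ≥0∞) (h : ∀ᵐ p ∂ρ.prod ρ, a p.1 * b p.2 ≤ c (p.1 ⊔ p.2) * d (p.1 ⊓ p.2)) :
    ∀ᵐ x ∂ρ, a x * b x ≤ c x * d x := by
  classical
  obtain ⟨s, hsc, hsd⟩ := TopologicalSpace.exists_countable_dense ℝ≥0∞
  set S : Set ℝ≥0∞ := insert 0 (insert ⊤ s) with hS
  have hSc : S.Countable := (hsc.insert _).insert _
  -- level sets indexed by four countable thresholds
  set G : ℝ≥0∞ × ℝ≥0∞ × ℝ≥0∞ × ℝ≥0∞ → Set X := fun t =>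
    {x | t.1 ≤ a x ∧ t.2.1 ≤ b x ∧ c x ≤ t.2.2.1 ∧ d x ≤ t.2.2.2} with hG
  set good : Set (ℝ≥0∞ × ℝ≥0∞ × ℝ≥0∞ × ℝ≥0∞) :=
    {t | t ∈ S ×ˢ S ×ˢ S ×ˢ S ∧ t.2.2.1 * t.2.2.2 < t.1 * t.2.1} with hgood
  have hgc : good.Countable := ((hSc.prod (hSc.prod (hSc.prod hSc))).mono fun t ht => ht.1)
  have hnull : ∀ t ∈ good, ρ (G t) = 0 := by
    intro t ht
    have hsub : G t ×ˢ G t ⊆ {p : X × X | ¬(a p.1 * b p.2 ≤ c (p.1 ⊔ p.2) * d (p.1 ⊓ p.2))} := by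
      rintro ⟨x, y⟩ ⟨hx, hy⟩
      simp only [hG, mem_setOf_eq] at hx hy
      have h1 : t.1 * t.2.1 ≤ a x * b y := mul_le_mul' hx.1 hy.2.1
      have h2 : c (x ⊔ y) * d (x ⊓ y) ≤ t.2.2.1 * t.2.2.2 := by
        rcases le_total x y with hxy | hxy
        · rw [sup_eq_right.2 hxy, inf_eq_left.2 hxy]; exact mul_le_mul' hy.2.2.1 hx.2.2.2
        · rw [sup_eq_left.2 hxy, inf_eq_right.2 hxy]; exact mul_le_mul' hx.2.2.1 hy.2.2.2
      exact fun hle => lt_irrefl _ (((h2.trans_lt ht.2).trans_le h1).trans_le hle)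
    have h0 : ρ.prod ρ (G t ×ˢ G t) = 0 := measure_mono_null hsub (ae_iff.1 h)
    rw [Measure.prod_prod] at h0
    exact mul_self_eq_zero.1 h0
  have hcover : {x | ¬(a x * b x ≤ c x * d x)} ⊆ ⋃ t ∈ good, G t := by
    intro x hx
    rw [mem_setOf_eq, not_le] at hx
    obtain ⟨α, hα, β, hβ, hαa, hβb, hlt⟩ := exists_thr_le_mul_gt hsd hx
    obtain ⟨γ, hγ, δ, hδ, hγc, hδd, hlt'⟩ := exists_thr_ge_mul_lt hsd hlt
    exact mem_iUnion₂.2 ⟨(α, β, γ, δ), ⟨⟨hα, hβ, hγ, hδ⟩, hlt'⟩, hαa, hβb, hγc, hδd⟩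
  rw [ae_iff]
  exact measure_mono_null hcover ((measure_biUnion_null_iff hgc).2 hnull)

/-- **The `2 × 2` step from the four a.e.-available inequalities**: on a linear order, the given pair inequality
at `(t, s)`, at `(s, t)`, and the two diagonal inequalities at `t` and at `s` imply
`a(t)b(s) + a(s)b(t) ≤ c(t)d(s) + c(s)d(t)`. [cite: KarlinRinott1980, §2, proof of Thm. 2.1 (the n = 1 comparison)] -/
theorem add_le_add_of_pair_of_diag {X : Type*} [LinearOrder X] {a b c d : X → ℝ≥0∞} {t s : X}
    (k₁ : a t * b s ≤ c (t ⊔ s) * d (t ⊓ s)) (k₂ : a s * b t ≤ c (s ⊔ t) * d (s ⊓ t))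
    (k₃ : a t * b t ≤ c t * d t) (k₄ : a s * b s ≤ c s * d s) :
    a t * b s + a s * b t ≤ c t * d s + c s * d t := by
  rcases le_total s t with hst | hts
  · rw [sup_eq_left.2 hst, inf_eq_right.2 hst] at k₁
    rw [sup_eq_right.2 hst, inf_eq_left.2 hst] at k₂
    exact ennreal_two_by_two_step k₁ k₂ k₃ (by simpa only [mul_comm] using k₄)
  · rw [sup_eq_right.2 hts, inf_eq_left.2 hts] at k₁
    rw [sup_eq_left.2 hts, inf_eq_right.2 hts] at k₂
    have H := ennreal_two_by_two_step k₂ k₁ k₄ (by simpa only [mul_comm] using k₃)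
    rwa [add_comm (a s * b t), add_comm (c s * d t)] at H

/-! ### Re-association of a fourfold product measure -/

/-- `((y,z),(t,s)) ↦ ((t,y),(s,z))` preserves the product measures (composition of `swap`s and `prodAssoc`s).
[folklore] -/
theorem measurePreserving_shuffle {α β γ δ : Type*} [MeasurableSpace α] [MeasurableSpace β]
    [MeasurableSpace γ] [MeasurableSpace δ] (μa : Measure α) (μb : Measure β) (μc : Measure γ)
    (μd : Measure δ) [SFinite μa] [SFinite μb] [SFinite μc] [SFinite μd] :
    MeasurePreserving (fun w : (α × β) × (γ × δ) => ((w.2.1, w.1.1), (w.2.2, w.1.2)))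
      ((μa.prod μb).prod (μc.prod μd)) ((μc.prod μa).prod (μd.prod μb)) := by
  have s1 : MeasurePreserving (Prod.swap : (α × β) × (γ × δ) → (γ × δ) × (α × β))
      ((μa.prod μb).prod (μc.prod μd)) ((μc.prod μd).prod (μa.prod μb)) := Measure.measurePreserving_swap
  have s2 : MeasurePreserving (MeasurableEquiv.prodAssoc : (γ × δ) × (α × β) ≃ᵐ γ × (δ × (α × β)))
      ((μc.prod μd).prod (μa.prod μb)) (μc.prod (μd.prod (μa.prod μb))) :=
    measurePreserving_prodAssoc μc μd (μa.prod μb)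
  have s3 : MeasurePreserving
      (Prod.map id (MeasurableEquiv.prodAssoc : (δ × α) × β ≃ᵐ δ × (α × β)).symm)
      (μc.prod (μd.prod (μa.prod μb))) (μc.prod ((μd.prod μa).prod μb)) :=
    (MeasurePreserving.id μc).prod ((measurePreserving_prodAssoc μd μa μb).symm _)
  have s4 : MeasurePreserving (Prod.map id (Prod.map Prod.swap id) : γ × ((δ × α) × β) → γ × ((α × δ) × β))
      (μc.prod ((μd.prod μa).prod μb)) (μc.prod ((μa.prod μd).prod μb)) :=
    (MeasurePreserving.id μc).prod (Measure.measurePreserving_swap.prod (MeasurePreserving.id μb))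
  have s5 : MeasurePreserving
      (Prod.map id (MeasurableEquiv.prodAssoc : (α × δ) × β ≃ᵐ α × (δ × β)))
      (μc.prod ((μa.prod μd).prod μb)) (μc.prod (μa.prod (μd.prod μb))) :=
    (MeasurePreserving.id μc).prod (measurePreserving_prodAssoc μa μd μb)
  have s6 : MeasurePreserving (MeasurableEquiv.prodAssoc : (γ × α) × (δ × β) ≃ᵐ γ × (α × (δ × β))).symm
      (μc.prod (μa.prod (μd.prod μb))) ((μc.prod μa).prod (μd.prod μb)) :=
    (measurePreserving_prodAssoc μc μa (μd.prod μb)).symm _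
  have e : (fun w : (α × β) × (γ × δ) => ((w.2.1, w.1.1), (w.2.2, w.1.2))) =
      (MeasurableEquiv.prodAssoc : (γ × α) × (δ × β) ≃ᵐ γ × (α × (δ × β))).symm ∘
        (Prod.map id (MeasurableEquiv.prodAssoc : (α × δ) × β ≃ᵐ α × (δ × β))) ∘
        (Prod.map id (Prod.map Prod.swap id) : γ × ((δ × α) × β) → γ × ((α × δ) × β)) ∘
        (Prod.map id (MeasurableEquiv.prodAssoc : (δ × α) × β ≃ᵐ δ × (α × β)).symm) ∘
        (MeasurableEquiv.prodAssoc : (γ × δ) × (α × β) ≃ᵐ γ × (δ × (α × β))) ∘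
        (Prod.swap : (α × β) × (γ × δ) → (γ × δ) × (α × β)) := by
    funext w
    rfl
  rw [e]
  exact s6.comp (s5.comp (s4.comp (s3.comp (s2.comp s1))))

end Summit.CriticalPhenomena.PercolationContinuityZ3.Theorems.SahiAEFourFunctions
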